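import Summits.CriticalPhenomena.CardyFormulaZ2.Theorems.ParafermionPrecompact.Negative.ParafermionPrecompactFalseOfUniformInnerEnvelope

/-!
# StrategistCensus2 — kernel-checked companion of STRATEGY-CENSUS.md (generation 2) for the crux
# `CardySusyWard.ParafermionPrecompact` (stmt-CriticalPhenomena-11293)

Seat `planner-cstrat-stmt-CriticalPhenomena-11293-s1-0`, 2026-08-17.  Generation 1 (`StrategistCensus.lean`, crux dir)
certified `typed ↔ ¬H`, `line_decides_notH`, `typed_of_boundAboveThird`, `canonical_split`, `child₂_iff_parent`,
`bulkNondegenerate_of_localisedMass`.  This file adds the three facts the gen-2 census leans on that became available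
AFTER gen 1 (Ikhlef–Ponsaing first passage a theorem since 02:24Z; p138858; p141764):

* `strengthened_refuted` (§Strengthen, S⁺₂): the collar-rigid strengthening of the typed decl — typed text PLUS the
  summability of the spin-1/3 vertex observable over the boundary collar of the diagonal anchor square (the shape an
  induction on scales would need) — is REFUTED OUTRIGHT, unconditionally, by the landed `totalVertexSum_lower`
  (p138858).  Rigidity converts "believed false" into "provably false"; it never makes the typed text provable.
* `typed_implies_not_UIE` / `typed_iff_not_H` (§Decomposition / §Negation bookkeeping): the typed decl denies the
  uniform inner envelope of crux 11387 (p141764, contrapositive) and is exactly `¬H` (p74235).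
* `refuted_the_day_UIE_lands` : the item's only possible closure is `refuted`, wired by name already.

No `sorry`; axioms expected: propext, Classical.choice, Quot.sound.
-/

noncomputable section

namespace Summit.CriticalPhenomena.CardyFormulaZ2.Cruxes.ParafermionPrecompact.StrategistCensus2

open MeasureTheory Filter Set Metric
open scoped Topology
open Literature.Probability.LatticeModels (DiscreteDobrushin ParafermionBulkNondegenerate)
open Literature.Probability.RandomPlanarGeometry (DobrushinDomain)
open Summit.CriticalPhenomena.CardyFormulaZ2.Theses.CardySusyWard (ParafermionPrecompact)
open Summit.CriticalPhenomena.CardyFormulaZ2.Cruxes.EdgePrecompact.QkzStripBoundaryArm (UniformInnerEnvelope)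
open Summit.CriticalPhenomena.CardyFormulaZ2.Theorems.ParafermionPrecompact.Negative (IsFamily VanishesOn
  parafermionPrecompact_iff_vanishing parafermionPrecompact_iff_not_bulkNondegenerate
  ParafermionPrecompact_false_of_UniformInnerEnvelope not_parafermionPrecompact_iff_bulkNondegenerate)
open Summit.CriticalPhenomena.CardyFormulaZ2.Theorems.ParafermionFamiliesToSLESix.StripAnchored
open Summit.CriticalPhenomena.CardyFormulaZ2.Theorems.ParafermionFamiliesToSLESix.StripAnchored.S5 (anchorDomain)

/-! ## §Strengthen — S⁺₂, the collar-rigid strengthening, refuted outright -/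

/-- The added rigidity: along every discretisation family of the diagonal anchor square on which the vertex observable
vanishes at scale `δ^{1/3}` on compacts, the TOTAL vertex sum (compact part + boundary collar) is frequently
`≤ η δ^{-5/3}` for every `η > 0` — i.e. the signed collar sum is summable at the wall scale.  (Verbatim the statement of
the sibling line's r5 stub `stub_anchorLayerSmall`, crux stmt-CriticalPhenomena-10814.) -/
def AnchorLayerSmall : Prop :=
  ∀ Λ : ℝ → DiscreteDobrushin, IsFamily anchorDomain Λ → VertexVanishes anchorDomain Λ → ∀ η > (0:ℝ),
    ∃ᶠ δ in 𝓝[>] (0:ℝ), ‖totalVertexSum (Λ δ) δ‖ ≤ η * δ ^ (-(5:ℝ) / 3)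

/-- **S⁺₂ := typed ∧ AnchorLayerSmall is refuted unconditionally.**  Proof: the typed text is vanishing on compacts
(`parafermionPrecompact_iff_vanishing`), so the layer hypothesis fires along the concrete anchor family of
`totalVertexSum_lower` (p138858: `c δ^{-5/3} ≤ ‖totalVertexSum‖` eventually, unconditional since Ikhlef–Ponsaing's
first passage is a theorem), contradiction at any `δ` where both hold. -/
theorem strengthened_refuted : ¬ (ParafermionPrecompact ∧ AnchorLayerSmall) := by
  rintro ⟨hP, hS⟩
  obtain ⟨Λ, hΛ, c, hc, hbig⟩ := totalVertexSum_lower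
  have hV : VertexVanishes anchorDomain Λ := fun K hK hKD =>
    (parafermionPrecompact_iff_vanishing.1 hP) anchorDomain Λ hΛ K hK hKD
  have hη : (0:ℝ) < c / 2 := by positivity
  have hsmall := hS Λ hΛ hV (c / 2) hη
  have hpos : ∀ᶠ δ in 𝓝[>] (0:ℝ), (0:ℝ) < δ := eventually_mem_nhdsWithin
  obtain ⟨δ, hle, hge, hδ0⟩ := (hsmall.and_eventually (hbig.and hpos)).exists
  have hpow : (0:ℝ) < δ ^ (-(5:ℝ) / 3) := Real.rpow_pos_of_pos hδ0 _
  have : c * δ ^ (-(5:ℝ) / 3) ≤ c / 2 * δ ^ (-(5:ℝ) / 3) := hge.trans hle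
  nlinarith

/-- Equivalently: under the typed text the sibling stub `stub_anchorLayerSmall` is FALSE — the typed decl and the
only remaining stub of line `strip-anchored-vertex-normalisation` (10814 r5) cannot both hold. -/
theorem anchorLayerSmall_false_of_typed (hP : ParafermionPrecompact) : ¬ AnchorLayerSmall :=
  fun hS => strengthened_refuted ⟨hP, hS⟩

/-- And conversely the stub alone already refutes the typed decl (this is 10814's `bulkNondegenerate_of_stubs` read on
11293). -/
theorem typed_false_of_anchorLayerSmall (hS : AnchorLayerSmall) : ¬ ParafermionPrecompact :=
  fun hP => strengthened_refuted ⟨hP, hS⟩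

/-! ## §Decomposition / §Negation bookkeeping — the only live edges are on the negation side -/

/-- The typed decl is exactly `¬H` (p74235, gen-1 `typed_iff_not_H`, re-exported for this file's readers). -/
theorem typed_iff_not_H : ParafermionPrecompact ↔ ¬ ParafermionBulkNondegenerate :=
  parafermionPrecompact_iff_not_bulkNondegenerate

/-- The typed decl denies crux 11387's uniform inner envelope (contrapositive of p141764). -/
theorem typed_implies_not_UIE (hP : ParafermionPrecompact) : ¬ UniformInnerEnvelope :=
  fun hU => ParafermionPrecompact_false_of_UniformInnerEnvelope hU hP

/-- The refutation chain, by name: `UIE → H` and `H ↔ ¬typed`; so the item closes `refuted` the day either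
`UniformInnerEnvelope` (11387) or `AnchorLayerSmall` (10814 r5) lands, and never `proved` unless `H` is false. -/
theorem refuted_the_day_UIE_lands (hU : UniformInnerEnvelope) : ParafermionBulkNondegenerate ∧ ¬ ParafermionPrecompact :=
  ⟨not_parafermionPrecompact_iff_bulkNondegenerate.1 (ParafermionPrecompact_false_of_UniformInnerEnvelope hU),
    ParafermionPrecompact_false_of_UniformInnerEnvelope hU⟩

end Summit.CriticalPhenomena.CardyFormulaZ2.Cruxes.ParafermionPrecompact.StrategistCensus2

end
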